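import Summits.RiemannHypothesis.RiemannHypothesis.Theorems.Splittings.BombieriTruncScreening

/-!
# Splittings — x-wuc (xiv-b1): the BAND GAP (K4) under Gram positivity and the EVENTUAL STRIP partner (row X-5s, hypothesis-explicit)

Cell rh-split, seat rh-split-x-wuc g5 (brief sha16 f79c5f09d8bcb036), card `run/shared/lean/pub/rh-split/cards/SPLIT-x-wuc.md` §11
(referee rh-split-ref g3 2026-08-27T06:23:10Z: REPLAY PASS of the scratch `HOME/rh-split-x-wuc/SplitXWucG5.lean`; lead RULING #35:
cut (xiv)).  Carved VERBATIM from that scratch (file of record sha16 66b013c38c58c722); sections as numbered there.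
* §5 `pairVec` (mirror-pair screening vector: pairing `−2`, cost `≤ 32κ²` on `E ⊆ [−1,1]`), `gap_of_boundedAway_level` (`√c/4 ≤ |Re ρ − ½|`),
  `repelled_of_boundedAway`; §6 `EventualStrip` (ES), `foz_of_eventualStrip_of_repelled`, row X-5s `rh_iff_eventualStrip_and_boundedAway`
  with row C5 (`hC5`), `RH → B′` (`hBrh`) and Gram positivity (`hG`) in HYPOTHESIS position.  [new-combination rows; kernel lemmas new]
HONEST LABEL: «SPLITTING SEARCH over kernel-typed RH-EQUIVALENCES; a splitting A ∧ B ⟹ RH is CONDITIONAL bookkeeping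
unless A and B are both proved; nothing here bears on the truth of RH.»
-/

set_option linter.dupNamespace false

noncomputable section

open scoped Classical ComplexConjugate
open Set Filter Topology Complex MeasureTheory

namespace Summit.RiemannHypothesis.RiemannHypothesis.Theorems.Splittings.BombieriTruncBandGap

open Literature.NumberTheory.LFunctions Literature.NumberTheory.LFunctions.Bombieri2000
open Summit.RiemannHypothesis.RiemannHypothesis.Theses.RuelleBand
open Summit.RiemannHypothesis.RiemannHypothesis.Theorems.Splittings.BombieriTruncEigen
open Summit.RiemannHypothesis.RiemannHypothesis.Theorems.Splittings.BombieriFozNoDep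
open Summit.RiemannHypothesis.RiemannHypothesis.Theorems.Splittings.BombieriTruncGram
open Summit.RiemannHypothesis.RiemannHypothesis.Theorems.Splittings.BombieriTruncPairing
open Summit.RiemannHypothesis.RiemannHypothesis.Theorems.Splittings.BombieriTruncScreening

variable {E : Set ℝ} {N : ℕ}

/-! ## §5 (K4) `B′` forces a BAND GAP: off-line zeros are repelled from the critical line

The antisymmetric pair vector `x = e_i − e_{ī}` of ONE off-line pair has `P`-pairing `−2` and Gram cost
`∫_E |e^{−κu} − e^{κu}|² du ≤ 32 κ²` (`κ = Re ρ_i − ½`, `E ⊆ [−1,1]`), so by (K2) the truncation has an eigenvalue in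
`(−16κ² − 0, 0)`; hence `B′(E)` with constant `c` forbids off-line zeros with `|Re ρ − ½| < √c/4` (given Gram
positivity): zeros close to the line are SELF-SCREENING. [new; elementary given K2] -/

/-- `i·γ_i = ρ_i − ½` for a zero index `i` (the tree's parametrisation `ρ = ½ + iγ`). -/
theorem I_mul_gamma (i : ZeroIdx) : I * i.gamma = i.val - 1 / 2 := by
  rw [ZeroIdx.gamma, ← mul_assoc, mul_neg, Complex.I_mul_I, neg_neg, one_mul]

/-- For the conjugate-partner index: `i·γ_{tbar i} = −conj(ρ_i − ½)`. -/
theorem I_mul_gamma_tbar (i : truncIdx N) :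
    I * ((tbar i : truncIdx N) : ZeroIdx).gamma = -conj (((i : truncIdx N) : ZeroIdx).val - 1 / 2) := by
  rw [gamma_tbar, ZeroIdx.gamma, map_mul, map_neg, Complex.conj_I, neg_neg, ← mul_assoc, Complex.I_mul_I,
    neg_one_mul]

/-- An off-line index is not its own partner: `tbar i ≠ i`. -/
theorem tbar_ne_self {i : truncIdx N} (h : (i : ZeroIdx).OffLine) : tbar i ≠ i := by
  intro h'
  have hv : ((tbar i : truncIdx N) : ZeroIdx).val = (i : ZeroIdx).val := by rw [h']
  rw [coe_tbar, ZeroIdx.val_bar] at hv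
  have hre := congrArg Complex.re hv
  simp at hre
  exact h (by linarith)

/-- `F_N` is additive: `F_N (x − y) = F_N x − F_N y`. -/
theorem F_sub (x y : truncIdx N → ℂ) (u : ℝ) : F N (x - y) u = F N x u - F N y u := by
  simp only [F, Pi.sub_apply, sub_mul, Finset.sum_sub_distrib]

/-- `F_N` of the basis vector `e_i` is the single exponential `u ↦ e^{−iγ_i u}`. -/
theorem F_single (i : truncIdx N) (u : ℝ) : F N (Pi.single i 1) u = cexp (-(I * (i : ZeroIdx).gamma * u)) := by
  rw [F, Finset.sum_eq_single i (fun j _ hj ↦ by simp [hj]) (by simp)]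
  simp

/-- The antisymmetric pair vector `e_i − e_{ī}` of the slot `i`. -/
def pairVec (i : truncIdx N) : truncIdx N → ℂ := Pi.single i 1 - Pi.single (tbar i) 1

/-- For an off-line index the pair vector `e_i − e_{tbar i}` has pairing `−2`. -/
theorem pairing_pairVec {i : truncIdx N} (h : (i : ZeroIdx).OffLine) :
    pairing N (pairVec i) (pairVec i) = -2 := by
  have hne : tbar i ≠ i := tbar_ne_self h
  have hne' : i ≠ tbar i := fun h' ↦ hne h'.symm
  rw [pairing, Fintype.sum_eq_add i (tbar i) hne' (fun j hj ↦ by simp [pairVec, Pi.single_apply, hj.1, hj.2])]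
  simp [pairVec, hne, hne', tbar_tbar]
  norm_num

/-- `|e^{−κu} − e^{κu}| ≤ 4|κ|` on `|u| ≤ 1` (`|κ| < ½`): the pair vector synthesises a SMALL function. -/
theorem norm_F_pairVec_le (i : truncIdx N) {u : ℝ} (hu : |u| ≤ 1) :
    ‖F N (pairVec i) u‖ ≤ 4 * |(i : ZeroIdx).val.re - 1 / 2| := by
  have hF : F N (pairVec i) u =
      cexp (-(((i : ZeroIdx).val - 1 / 2) * u)) - cexp (conj ((i : ZeroIdx).val - 1 / 2) * u) := by
    rw [pairVec, F_sub, F_single, F_single, I_mul_gamma ((i : truncIdx N) : ZeroIdx), I_mul_gamma_tbar i,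
      neg_mul, neg_neg]
  set z : ℂ := (i : ZeroIdx).val - 1 / 2 with hz
  set κ : ℝ := (i : ZeroIdx).val.re - 1 / 2 with hκ
  have hzre : z.re = κ := by simp [hz, hκ]
  have hκ1 : |κ| ≤ 1 := by
    have h := (i : ZeroIdx).re_pos_and_lt_one
    rw [hκ, abs_le]
    constructor <;> linarith [h.1, h.2]
  have h1 : -(z * (u : ℂ)) = ((-(κ * u) : ℝ) : ℂ) + ((-(z.im * u) : ℝ) : ℂ) * I := by
    apply Complex.ext <;> simp [hzre]
  have h2 : conj z * (u : ℂ) = ((κ * u : ℝ) : ℂ) + ((-(z.im * u) : ℝ) : ℂ) * I := by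
    apply Complex.ext <;> simp [hzre]
  rw [hF, h1, h2, Complex.exp_add, Complex.exp_add, ← sub_mul, norm_mul, Complex.norm_exp_ofReal_mul_I, mul_one,
    ← Complex.ofReal_exp, ← Complex.ofReal_exp, ← Complex.ofReal_sub, Complex.norm_real, Real.norm_eq_abs]
  have hκu : |κ * u| ≤ 1 := by
    rw [abs_mul]
    calc |κ| * |u| ≤ 1 * 1 := mul_le_mul hκ1 hu (abs_nonneg u) zero_le_one
      _ = 1 := one_mul 1
  have e1 : |Real.exp (-(κ * u)) - 1| ≤ 2 * |-(κ * u)| := Real.abs_exp_sub_one_le (by rwa [abs_neg])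
  have e2 : |Real.exp (κ * u) - 1| ≤ 2 * |κ * u| := Real.abs_exp_sub_one_le hκu
  calc |Real.exp (-(κ * u)) - Real.exp (κ * u)|
      ≤ |Real.exp (-(κ * u)) - 1| + |1 - Real.exp (κ * u)| := abs_sub_le _ _ _
    _ = |Real.exp (-(κ * u)) - 1| + |Real.exp (κ * u) - 1| := by rw [abs_sub_comm 1]
    _ ≤ 2 * |-(κ * u)| + 2 * |κ * u| := add_le_add e1 e2
    _ = 4 * (|κ| * |u|) := by rw [abs_neg, abs_mul]; ring
    _ ≤ 4 * (|κ| * 1) := by gcongr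
    _ = 4 * |κ| := by ring

/-- Gram cost of the pair vector on a window `E ⊆ [−1,1]`: `≤ 32 (Re ρ − ½)²`. -/
theorem cost_pairVec_le (hE : E ⊆ Icc (-1 : ℝ) 1) (i : truncIdx N) :
    ∫ u in E, ‖F N (pairVec i) u‖ ^ 2 ≤ 32 * ((i : ZeroIdx).val.re - 1 / 2) ^ 2 := by
  set κ : ℝ := (i : ZeroIdx).val.re - 1 / 2 with hκ
  have hfin : volume E < ⊤ := (measure_mono hE).trans_lt measure_Icc_lt_top
  have h := norm_setIntegral_le_of_norm_le_const hfin (f := fun u ↦ ‖F N (pairVec i) u‖ ^ 2)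
    (C := 16 * κ ^ 2) fun u hu ↦ by
      rw [Real.norm_of_nonneg (by positivity)]
      have hu' : |u| ≤ 1 := abs_le.2 ⟨(hE hu).1, (hE hu).2⟩
      have hb : ‖F N (pairVec i) u‖ ≤ 4 * |κ| := norm_F_pairVec_le i hu'
      have h0 : 0 ≤ ‖F N (pairVec i) u‖ := norm_nonneg _
      calc ‖F N (pairVec i) u‖ ^ 2 ≤ (4 * |κ|) ^ 2 := pow_le_pow_left₀ h0 hb 2
        _ = 16 * κ ^ 2 := by rw [mul_pow, sq_abs]; norm_num
  have h0 : 0 ≤ ∫ u in E, ‖F N (pairVec i) u‖ ^ 2 := integral_nonneg fun u ↦ by positivity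
  rw [Real.norm_of_nonneg h0] at h
  have hvol : volume.real E ≤ 2 := by
    calc volume.real E ≤ volume.real (Icc (-1 : ℝ) 1) := measureReal_mono hE measure_Icc_lt_top.ne
      _ = 2 := by rw [measureReal_def, Real.volume_Icc, ENNReal.toReal_ofReal (by norm_num)]; norm_num
  calc ∫ u in E, ‖F N (pairVec i) u‖ ^ 2 ≤ 16 * κ ^ 2 * volume.real E := h
    _ ≤ 16 * κ ^ 2 * 2 := mul_le_mul_of_nonneg_left hvol (by positivity)
    _ = 32 * κ ^ 2 := by ring

/-- **(K4) band gap at one level.** If at level `N` the Gram form is positive definite and every negative real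
eigenvalue of `𝒦_E(Γ_N)` is `≤ −c`, then every off-line slot of `Γ_N` has `|Re ρ − ½| ≥ √c / 4`. [new] -/
theorem gap_of_boundedAway_level (hE : E ⊆ Icc (-1 : ℝ) 1) {c : ℝ} (hc : 0 < c) (hG : GramPosDef E N)
    (hB : ∀ μ ∈ (truncKMat E N).charpoly.roots, μ.im = 0 → μ.re < 0 → μ.re ≤ -c)
    (i : truncIdx N) (hi : (i : ZeroIdx).OffLine) : Real.sqrt c / 4 ≤ |(i : ZeroIdx).val.re - 1 / 2| := by
  by_contra hlt
  push Not at hlt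
  set κ : ℝ := (i : ZeroIdx).val.re - 1 / 2 with hκ
  have hκ2 : κ ^ 2 < c / 16 := by
    have h1 : |κ| * |κ| < (Real.sqrt c / 4) * (Real.sqrt c / 4) := mul_self_lt_mul_self (abs_nonneg κ) hlt
    rw [abs_mul_abs_self, div_mul_div_comm, Real.mul_self_sqrt hc.le] at h1
    nlinarith [h1]
  have hp : (pairing N (pairVec i) (pairVec i)).re = -2 := by
    rw [pairing_pairVec hi]; simp
  have hx : ∫ u in E, ‖F N (pairVec i) u‖ ^ 2 < c * -(pairing N (pairVec i) (pairVec i)).re := by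
    rw [hp]
    have hcost := cost_pairVec_le hE i
    rw [← hκ] at hcost
    linarith
  obtain ⟨μ, hμ, him, hlo, hhi⟩ := exists_negRoot_of_screening (a := 1) hE hG hc hx
  have := hB μ hμ him hhi
  linarith

/-- An index with `‖ρ_i − ½‖ ≤ N` belongs to the truncation window `Γ_N`. -/
theorem mem_truncIdx_of_le {N : ℕ} {i : ZeroIdx} (h : ‖i.val - 1 / 2‖ ≤ N) : i ∈ truncIdx N := by
  rw [truncIdx, Set.Finite.mem_toFinset]
  exact h

/-- **(K4) `B′` ⟹ REPELLED.** If the Gram forms are positive definite at every level (e.g. all zeros simple) and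
`B′(E)` holds on a window `E ⊆ [−1,1]`, then there is `η₀ > 0` with `|Re ρ − ½| ≥ η₀` for EVERY off-line zero:
a zero-free band around the critical line (the line itself excepted). [new] -/
theorem repelled_of_boundedAway (hE : E ⊆ Icc (-1 : ℝ) 1) (hG : ∀ N, GramPosDef E N)
    (hB : TruncNegEigenvalueBoundedAway E) :
    ∃ η₀ : ℝ, 0 < η₀ ∧ ∀ i : ZeroIdx, i.OffLine → η₀ ≤ |i.val.re - 1 / 2| := by
  obtain ⟨c, hc, N₀, hN₀⟩ := hB
  refine ⟨Real.sqrt c / 4, div_pos (Real.sqrt_pos.2 hc) (by norm_num), fun i hi ↦ ?_⟩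
  set N : ℕ := max N₀ ⌈‖i.val - 1 / 2‖⌉₊ with hN
  have hmem : i ∈ truncIdx N :=
    mem_truncIdx_of_le ((Nat.le_ceil _).trans (by exact_mod_cast le_max_right N₀ _))
  exact gap_of_boundedAway_level hE hc (hG N) (hN₀ N (le_max_left _ _)) ⟨i, hmem⟩ hi

/-! ## §6 (K5) Row X-5s: `RH ⟺ ES ∧ B′([−1,1])` — the partner FOZ of row C5 weakened to the EVENTUAL STRIP

`ES` kills exactly the worlds that (K4) leaves alive: with infinitely many off-line zeros REPELLED from the line.
So `ES ∧ B′ ⟹ FOZ ∧ B′ ⟹ RH` (row C5). -/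

/-- **ES (eventual strip).** For every `η > 0` only finitely many non-trivial zeros have `|Re ρ − ½| ≥ η`: off-line
zeros, if infinitely many, accumulate only toward the critical line. RH-implied (vacuously), implied by FOZ, and it
does NOT exclude infinitely many off-line zeros. [new conjecture-shaped def; rh-split x-wuc g5] -/
@[conjecture] def EventualStrip : Prop :=
  ∀ η : ℝ, 0 < η → {ρ : ℂ | ρ ∈ ZetaZeros.riemannZetaNontrivialZeros ∧ η ≤ |ρ.re - 1 / 2|}.Finite

/-- FOZ (`CofiniteCriticalLine`) implies `EventualStrip` (finitely many zeros at distance `≥ η` from the line, for every `η > 0`). -/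
theorem eventualStrip_of_foz (h : CofiniteCriticalLine) : EventualStrip := by
  intro η hη
  refine (cofiniteCriticalLine_iff_foz.1 h).subset fun ρ hρ ↦ ⟨hρ.1, fun hre ↦ ?_⟩
  have h2 := hρ.2
  rw [hre, sub_self, abs_zero] at h2
  linarith

/-- RH implies `EventualStrip` (RH-implied conjunct). -/
theorem eventualStrip_of_rh (hRH : _root_.RiemannHypothesis) : EventualStrip :=
  eventualStrip_of_foz (cofiniteCriticalLine_of_rh hRH)

/-- Every non-trivial zero owns a slot of `Γ` (its multiplicity is `≥ 1`). -/
theorem exists_slot {ρ : ℂ} (hρ : ρ ∈ ZetaZeros.riemannZetaNontrivialZeros) : ∃ i : ZeroIdx, i.val = ρ := by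
  obtain ⟨h0, h1, h2⟩ := mem_riemannZetaNontrivialZeros_iff_holds.1 hρ
  have hne : ρ ≠ 1 := by
    rintro rfl
    simp at h2
  have hpos : 0 < riemannZetaZeroOrder ρ := (riemannZetaZeroOrder_pos_iff hne).2 h0
  have hpos' : 0 < (riemannZetaZeroOrder ρ).toNat := by omega
  exact ⟨⟨⟨ρ, hρ⟩, ⟨0, hpos'⟩⟩, rfl⟩

/-- `EventualStrip` plus a uniform repulsion `η₀ ≤ |Re ρ − ½|` of every off-line zero gives FOZ. -/
theorem foz_of_eventualStrip_of_repelled (hES : EventualStrip)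
    (hrep : ∃ η₀ : ℝ, 0 < η₀ ∧ ∀ i : ZeroIdx, i.OffLine → η₀ ≤ |i.val.re - 1 / 2|) : CofiniteCriticalLine := by
  obtain ⟨η₀, hη₀, h⟩ := hrep
  refine cofiniteCriticalLine_iff_foz.2 ((hES η₀ hη₀).subset fun ρ hρ ↦ ⟨hρ.1, ?_⟩)
  obtain ⟨i, hi⟩ := exists_slot hρ.1
  have h' := h i (by show i.val.re ≠ 1 / 2; rw [hi]; exact hρ.2)
  rwa [hi] at h'

/-- **Row X-5s (kernel; row C5 in hypothesis position = g4 `rh_of_foz_of_boundedAway_one h`).** Given Gram positivity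
at every level, `ES ∧ B′([−1,1]) ⟹ RH`: `B′` repels the off-line zeros from the line (K4), `ES` then leaves only
finitely many, and row C5 concludes. [new-combination] -/
theorem rh_of_eventualStrip_of_boundedAway
    (hC5 : CofiniteCriticalLine → TruncNegEigenvalueBoundedAway (Icc (-1) 1) → _root_.RiemannHypothesis)
    (hG : ∀ N, GramPosDef (Icc (-1) 1) N) (hES : EventualStrip)
    (hB : TruncNegEigenvalueBoundedAway (Icc (-1) 1)) : _root_.RiemannHypothesis :=
  hC5 (foz_of_eventualStrip_of_repelled hES (repelled_of_boundedAway subset_rfl hG hB)) hB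

/-- Row X-5s as an EQUIVALENCE modulo row C5 (`hC5`), `RH → B′` (g4 `truncNegEigenvalueBoundedAway_Icc_of_rh`, `hBrh`)
and Gram positivity: `RH ⟺ ES ∧ B′([−1,1])`. [new-combination] -/
theorem rh_iff_eventualStrip_and_boundedAway
    (hC5 : CofiniteCriticalLine → TruncNegEigenvalueBoundedAway (Icc (-1) 1) → _root_.RiemannHypothesis)
    (hBrh : _root_.RiemannHypothesis → TruncNegEigenvalueBoundedAway (Icc (-1) 1))
    (hG : ∀ N, GramPosDef (Icc (-1) 1) N) :
    _root_.RiemannHypothesis ↔ EventualStrip ∧ TruncNegEigenvalueBoundedAway (Icc (-1) 1) :=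
  ⟨fun h ↦ ⟨eventualStrip_of_rh h, hBrh h⟩, fun h ↦ rh_of_eventualStrip_of_boundedAway hC5 hG h.1 h.2⟩

end Summit.RiemannHypothesis.RiemannHypothesis.Theorems.Splittings.BombieriTruncBandGap
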